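import Summits.QuantumAdvantage.AdviceFreeQNC0.WalkFailSetHits
import Summits.QuantumAdvantage.AdviceFreeQNC0.SPSRingFail
import HarnessLib

/-!
# Route RingFrame, crux α `RingToElim` (stmt-QuantumAdvantage-19119): FAIL-SET HITS read on the
# ring — every polynomial device of degree `D` for the `(n+1)`-cycle errs on at least
# `2^{n−m} · Σ_{j≤D'} C(m, j)` measurement patterns, `2D + 4D' + 3 ≤ m ≤ n`

Support theorem for the crux item α in the language of the rung leaf `RingHard 2`
(`Literature…RingHLF.Rel`), transported from the cell's FAIL-SET-HITS floor of the walk game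
(`ringWinU_failSetHits`, `AdviceFreeQNC0/WalkFailSetHits.lean`: fail sets of degree-`D` strategies
are interpolating sets for degree `D'`, planner qa-qnc0-p1 TARGET §15.4(b)) through the affine
chart of `WalkTransport.lean` (`hasDeg_transport`):

* transport of fail counts: `SPSRingFail.card_fail_le_card_not_rel` (prover qn-prover gen 7: each
  failing walk input lifts to an odd-class pattern violating `Rel`, `rel_iff_ringWinU`);
* **`ringRel_failSetHits`** — for `D ≥ 1`, `2D + 4D' + 3 ≤ m ≤ n` and every tuple `P` of
  `𝔽₂`-polynomials of degree `≤ D` on `{0,1}^{n+1}`, the relation `Rel x (P x)` FAILS for at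
  least `2^{n−m} · N_{D'}(m)` patterns `x`, `N_{D'}(m) = Σ_{j≤D'} C(m,j)`
  (`Literature…Smolensky.numMonomials`).

Numbers: `D' = 0` is the fail floor `ringRel_fail_floor` (`2^{n−2D−3}`); at `D = 20, D' = 4,
m = 59` the bound is `2^{n−40.1}` (floor `2^{n−43}`), at `D = 80, D' = 19, m = 239` it is
`2^{n−146.6}` (floor `2^{n−163}`); asymptotically `2^{n−1.757·D}` along `D = 4D'` versus
`2^{n−2D}`.  The cell's statement (prover qn-prover-3 gen 6; a special case / instrument for
crux α of route RingFrame); not in print.  WHAT THIS IS NOT: not a constant-loss bound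
(`RingHard 2` / α untouched); density-axis exponent `≈ 1.76`, not `< 1`; no separation claim.
-/

-- the sub-problem namespace `Summit.QuantumAdvantage.QuantumAdvantage` repeats the summit name by design (D-0017)
set_option linter.dupNamespace false

noncomputable section

namespace Summit.QuantumAdvantage.QuantumAdvantage.Theorems

open Finset Summit.QuantumAdvantage.AdviceFreeQNC0
open Literature.Computability.QuantumComplexity Literature.Computability.QuantumComplexity.RingHLF
open Literature.Computability.MetaComplexity Literature.Computability.MetaComplexity.Smolensky

/-- **FAIL-SET HITS ON THE RING.**  For `D ≥ 1`, `2D + 4D' + 3 ≤ m ≤ n` and every tuple `P` of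
`𝔽₂`-polynomials of degree `≤ D` on the patterns of the `(n+1)`-cycle, `Rel x (P x)` fails for
at least `2^{n−m} · Σ_{j ≤ D'} C(m, j)` patterns `x`. [folklore] -/
theorem ringRel_failSetHits (D D' : ℕ) (hD : 1 ≤ D) {m n : ℕ} (hm : 2 * D + 4 * D' + 3 ≤ m)
    (hn : m ≤ n) (P : Fin (n + 1) → CubeFn (ZMod 2) (n + 1))
    (hP : ∀ i, P i ∈ lowDeg (ZMod 2) (n + 1) D) :
    2 ^ (n - m) * numMonomials m D' ≤
      (univ.filter fun x : Fin (n + 1) → Bool => ¬ Rel x (fun i => decide (P i x = 1))).card := by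
  classical
  set z : (Fin (n + 1) → Bool) → (Fin (n + 1) → Bool) := fun x i => decide (P i x = 1) with hz
  have hdeg : ∀ g, HasDeg ((fun g u => xor (z (xOfU u) g) (tGuess (xOfU u) g)) g) D :=
    fun g => hasDeg_transport hD (P g) (hP g) g
  exact le_trans (ringWinU_failSetHits D D' hm hn (n + 2) _ hdeg) (SPSRingFail.card_fail_le_card_not_rel (by omega) z)

end Summit.QuantumAdvantage.QuantumAdvantage.Theorems

end
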